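import Summits.BirchSwinnertonDyer.Rank1Residual.Additive.QuadraticBranchSignedMainConjecture
import Summits.BirchSwinnertonDyer.Rank1Residual.Additive.CyclotomicTowerSignedSelmer
import Literature.NumberTheory.EllipticCurves.Kobayashi2003.SignedSelmerDualExistsProofs
import Literature.NumberTheory.EllipticCurves.IwasawaAlgebraProofs
import Literature.NumberTheory.EllipticCurves.CyclotomicIwasawaMainTheoremIrreducibleProofs
import HarnessLib

/-!
(Header-only revision 2026-08-26, planner bsd-potss-plan g11 ASK: this module no longer imports any
`Theses.*` file — imports = Additive + Literature only — so the route file can import it; declarations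
byte-identical.)

# Route `QuadraticBranchSignedControl` (rung K8, cell `bsd-potss`), crux `EtaTransportSigned`
# (item stmt-BirchSwinnertonDyer-19115), registered stub `stub_etaMC_plus`: the PLUS `η`-component
# frame FROM the `F`-form (C1_η) — the Iwasawa-algebra half, over ONE displayed decomposition frame

WHAT. The plus conjunct of `EtaTransportSigned` (= the registered stub `Sig.stub_etaMC_plus` of the
BC3 skeleton, verbatim): for `p ≥ 5`, `K₀ = ℚ(μ_p)` (any cyclotomic model), `η` the quadratic
character of `Gal(K₀/ℚ)`, `V/ℚ` good at `p` with `a_p(V) = 0` satisfying the typed `F`-form (C1_η)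
`QuadraticBranchPlusMainConjectureAt V p` (`Char X⁺(V/F_∞) = Char X⁺(V/ℚ_∞) · (L_p⁺(V, η, X))`,
`F = ℚ(√p*)`), every Pontryagin-dual datum `D` of the `η`-component `Sel⁺(V/K₀ℚ_∞)^η`
(`EtaSignedSelmerDualData V κ K₀ ℚ_[p] η γ 1`) is finitely generated `Λ`-torsion with
`Char = (L_p⁺(V, η, X))` — PROVED HERE MODULO ONE DISPLAYED FRAME `hdec`, the prime-to-`p` descent /
signed base change of the reading flag `Kob03-MC-eta-quadratic-subtower`
(`QuadraticBranchSignedMainConjecture.lean`, module docstring): a `Γ`-equivariant additive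
isomorphism `Sel⁺(V'/F_∞) ≃ Sel⁺(V/ℚ_∞) ⊕ Sel⁺(V/K₀ℚ_∞)^η` for SOME quadratic model
(`F`, `V'`, `κF`, `γF`) admissible for (C1_η) (`[F : ℚ] = 2`, `√p* ∈ F`, `V' ≅ V_F`, `κF` cyclotomic
with generator `γF` matching the cyclotomic variable) — Kobayashi 2003 §4 p. 8 read over
`F ⊂ K_0` (`p ∤ [K_∞ : F_∞]`, `p ∤ [F_∞ : ℚ_∞] = 2`; Greenberg LNM 1716 §3 for the classical
conditions). The frame is the cell's piece (i) of T-e2-R1⁺ (ctrl memo v7 §2j: bricks (i-b)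
`QuadraticTowerRestrict`, (i-c3) `BaseChangeSubgroupH1`, (i-d) `SignedTwistTowerTwist`, (i-e)
`SignedTwistPlusInvariantPart` landed; (i-a), (i-c), (i-f) open) and is NOT proved here.

PROOF (this file = ctrl's (i-g), the `Λ`-algebra). Given `D_η`, take Kobayashi's dual datum `D₀` of
`Sel⁺(V/ℚ_∞)` at `γ` (`Kobayashi2003.signedSelmerDualData`, EXISTS), the frame's `(F, V', κF, γF, Φ)`,
and BUILD the dual datum `DF` of `Sel⁺(V'/F_∞)` with module `D₀.X × D_η.X` (character groups of a
direct sum; `T = γF − 1` matches `T = γ − 1` on both summands by the equivariance of `Φ`; constants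
through `ℤ_p → ℤ/pᵏ`). (C1_η) at `(F, V', …, D₀, DF)` gives: `D₀.X × D_η.X` finitely generated
torsion and `Char(D₀.X × D_η.X) = Char D₀.X · (L_η)`; multiplicativity of `Char` in
`0 → D₀.X → D₀.X × D_η.X → D_η.X → 0` (`charIdeal_mul_of_shortExact_holds`) and cancellation of the
nonzero principal ideal `Char D₀.X` (`charIdeal_isPrincipal_holds`, `Module.charIdeal_ne_bot`) in the
domain `Λ = ℤ_p⟦T⟧` give `Char D_η.X = (L_η)`. Kobayashi's Thm. 2.2 is NOT used (torsion of both
summands is read off (C1_η)'s own conclusion).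

HONEST FRAMING (cell `bsd-potss`, run/shared/lean/pub/bsd-potss/; FULL-BSD rank ≤ 1 programme):
TOOL THEOREM ONLY — no definition, no named Literature fact, no `sorry`, axioms standard.
CONDITIONAL on the displayed frame `hdec` (WANTED on the cell bus; it is the Galois-cohomological
content of the stub) and, inside the statement, on (C1_η) (an OPEN conjecture in print, hypothesis
position). The stub / the crux / the item are NOT closed by this file; nothing is booked; no label
or count moves; `BSD(W, p)` is claimed for no pair. Seat `bsd-potss-k8q-c3` (prover), g0.

References: [Kobayashi2003] Def. 2.1, Thm. 2.2 (p. 5), §3 (p. 5, `γ ↔ 1 + X`), §4 p. 8 (even main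
conjecture at `η`; `M^η = ε_η M`); [GreenbergLNM1716] §1 (p. 60: the `Λ`-module structure on
Pontryagin duals), §3 (descent in prime-to-`p` extensions); Bourbaki AC VII §4.5 (multiplicativity
of characteristic ideals); [Washington1997] §13.2.
-/

set_option autoImplicit false
set_option linter.dupNamespace false

noncomputable section

open scoped Classical MatrixGroups ModularForm

open CongruenceSubgroup Field WeierstrassCurve
open Literature.NumberTheory.EllipticCurves
open Literature.NumberTheory.EllipticCurves.ModularForms
open Literature.NumberTheory.EllipticCurves.Kobayashi2003
open Literature.NumberTheory.GaloisRepresentations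
open Summit.BirchSwinnertonDyer.Rank1Residual.Additive

namespace Summit.BirchSwinnertonDyer.BirchSwinnertonDyer.Theorems

/-- **The `Λ`-algebra of the `η`-descent (ctrl's piece (i-g)), abstract form.** If a `Λ`-module
`X₀ × X_η` is finitely generated torsion with `Char(X₀ × X_η) = Char X₀ · (L)` over the Iwasawa
algebra `Λ = ℤ_p⟦T⟧` (a domain in which every characteristic ideal is a nonzero principal ideal),
then `X_η` is finitely generated torsion with `Char X_η = (L)`: multiplicativity of `Char` in the
split exact sequence `0 → X₀ → X₀ × X_η → X_η → 0` and cancellation of `Char X₀ = (a)`, `a ≠ 0`.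
[cite: Washington1997, §13.2 (characteristic ideals over Λ)] -/
theorem finite_isTorsion_charIdeal_snd_of_prod {p : ℕ} [Fact p.Prime] {X₀ X₁ : Type}
    [AddCommGroup X₀] [Module (IwasawaAlgebra p) X₀] [AddCommGroup X₁]
    [Module (IwasawaAlgebra p) X₁] (L : IwasawaAlgebra p)
    (hfin : Module.Finite (IwasawaAlgebra p) (X₀ × X₁))
    (htor : Module.IsTorsion (IwasawaAlgebra p) (X₀ × X₁))
    (hchar : Module.charIdeal (IwasawaAlgebra p) (X₀ × X₁) =
      Module.charIdeal (IwasawaAlgebra p) X₀ * Ideal.span {L}) :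
    Module.Finite (IwasawaAlgebra p) X₁ ∧ Module.IsTorsion (IwasawaAlgebra p) X₁ ∧
      Module.charIdeal (IwasawaAlgebra p) X₁ = Ideal.span {L} := by
  haveI := hfin
  have hfin₁ : Module.Finite (IwasawaAlgebra p) X₁ :=
    Module.Finite.of_surjective (LinearMap.snd (IwasawaAlgebra p) X₀ X₁) LinearMap.snd_surjective
  have htor₁ : Module.IsTorsion (IwasawaAlgebra p) X₁ := by
    intro x
    obtain ⟨a, ha⟩ := @htor (0, x)
    exact ⟨a, by simpa using congrArg Prod.snd ha⟩
  have hmul : Module.charIdeal (IwasawaAlgebra p) (X₀ × X₁) =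
      Module.charIdeal (IwasawaAlgebra p) X₀ * Module.charIdeal (IwasawaAlgebra p) X₁ :=
    charIdeal_mul_of_shortExact_holds p (X₀ × X₁) htor (LinearMap.inl (IwasawaAlgebra p) X₀ X₁)
      (LinearMap.snd (IwasawaAlgebra p) X₀ X₁) LinearMap.inl_injective LinearMap.snd_surjective
      .inl_snd
  obtain ⟨a, ha⟩ := (charIdeal_isPrincipal_holds p X₀).principal
  have ha' : Module.charIdeal (IwasawaAlgebra p) X₀ = Ideal.span {a} := ha
  have ha0 : a ≠ 0 := by
    intro h
    apply Module.charIdeal_ne_bot (IwasawaAlgebra p) X₀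
    rw [ha', h, Ideal.span_singleton_eq_bot]
  refine ⟨hfin₁, htor₁, ?_⟩
  rw [hmul, ha'] at hchar
  exact (Ideal.span_singleton_mul_right_inj ha0).mp hchar

/-- Character groups of a direct sum: if `Φ : A ≃ B × C` and `t_B : X_B → Hom(B, Q)`,
`t_C : X_C → Hom(C, Q)` are bijections, then `(x_B, x_C) ↦ t_B(x_B) ∘ pr₁ ∘ Φ + t_C(x_C) ∘ pr₂ ∘ Φ`
is a bijection `X_B × X_C → Hom(A, Q)` (Pontryagin dual of a direct sum; pure algebra). [folklore] -/
theorem bijective_dualOfProd {A B C X_B X_C Q : Type*} [AddCommGroup A] [AddCommGroup B]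
    [AddCommGroup C] [AddCommGroup Q] (Φ : A ≃+ B × C) (tB : X_B → (B →+ Q))
    (tC : X_C → (C →+ Q)) (hB : Function.Bijective tB) (hC : Function.Bijective tC) :
    Function.Bijective (fun x : X_B × X_C =>
      (tB x.1).comp ((AddMonoidHom.fst B C).comp Φ.toAddMonoidHom) +
        (tC x.2).comp ((AddMonoidHom.snd B C).comp Φ.toAddMonoidHom)) := by
  constructor
  · intro x y hxy
    have h : ∀ a, tB x.1 (Φ a).1 + tC x.2 (Φ a).2 = tB y.1 (Φ a).1 + tC y.2 (Φ a).2 :=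
      fun a => DFunLike.congr_fun hxy a
    refine Prod.ext (hB.1 ?_) (hC.1 ?_)
    · ext b
      simpa using h (Φ.symm (b, 0))
    · ext c
      simpa using h (Φ.symm (0, c))
  · intro φ
    obtain ⟨xB, hxB⟩ := hB.2 ((φ.comp Φ.symm.toAddMonoidHom).comp (AddMonoidHom.inl B C))
    obtain ⟨xC, hxC⟩ := hC.2 ((φ.comp Φ.symm.toAddMonoidHom).comp (AddMonoidHom.inr B C))
    refine ⟨(xB, xC), ?_⟩
    ext a
    simp only [hxB, hxC, AddMonoidHom.add_apply, AddMonoidHom.comp_apply,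
      AddMonoidHom.coe_fst, AddMonoidHom.coe_snd, AddMonoidHom.inl_apply,
      AddMonoidHom.inr_apply, AddEquiv.toAddMonoidHom_eq_coe, AddMonoidHom.coe_coe]
    rw [← map_add, ← map_add, Prod.mk_add_mk, add_zero, zero_add, Prod.mk.eta,
      AddEquiv.symm_apply_apply]

/-- **Stub `stub_etaMC_plus` of crux `EtaTransportSigned` MODULO the decomposition frame** (the
statement after `hdec` is the registered stub signature `Sig.stub_etaMC_plus` verbatim = the first
conjunct of `Summit.BirchSwinnertonDyer.BirchSwinnertonDyer.Theses.QuadraticBranchSignedControl.EtaTransportSigned`).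
`hdec` = the prime-to-`p` descent of the reading flag `Kob03-MC-eta-quadratic-subtower`: for the
stub's binders there are a quadratic field `F ∋ √p*`, an `F`-model `V'` of `V`, a cyclotomic
`ℤ_p`-extension `κF` of `F` with a generator `γF` matching the cyclotomic variable `1 + p` up to a
root of unity, and an additive isomorphism `Φ : Sel⁺(V'/F_∞) ≃ Sel⁺(V/ℚ_∞) × Sel⁺(V/K₀ℚ_∞)^η`
(Kobayashi's Def. 1.1 object over `F`, resp. over `ℚ`, and the `η`-component of his Def. 2.1 object
over `K_∞ = K₀ℚ_∞`) intertwining `conj_{γF}` with `conj_γ` on both factors. Given `hdec`, the even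
main conjecture at `η` for `X⁺(V/K_∞)^η` follows from its `F`-form (C1_η) by the `Λ`-algebra of
`finite_isTorsion_charIdeal_snd_of_prod` applied to the dual datum of `Sel⁺(V'/F_∞)` built on
`D₀.X × D.X`. CONDITIONAL on `hdec`; (C1_η) sits in hypothesis position; nothing is asserted about
either. [cite: Kobayashi2003, §4 p. 8 (even main conjecture at η), Def. 2.1 and Thm. 2.2 (p. 5), §3 p. 5]
[cite: GreenbergLNM1716, §1 (p. 60) and §3] -/
theorem etaTransportPlus_of_decomposition
    (hdec : ∀ (p : ℕ) [Fact p.Prime], 5 ≤ p →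
      ∀ (K₀ : Type) [Field K₀] [NumberField K₀] [IsCyclotomicExtension {p} ℚ K₀]
        [(galRange (K := ℚ) K₀).Normal] (ηq : absoluteGaloisGroup ℚ →* ℤˣ),
        (∀ σ ∈ galRange (K := ℚ) K₀, ηq σ = 1) → ηq ≠ 1 →
      ∀ (V : WeierstrassCurve ℚ) [V.IsElliptic] [V.IsGloballyMinimal],
        V.HasGoodReductionAtPrime p → V.frobeniusTrace p = 0 →
      ∀ (κ : ZpExtension ℚ p) (γ : absoluteGaloisGroup ℚ),
        κ.IsCyclotomic → κ.IsTopGenerator γ → γ ∈ galRange (K := ℚ) K₀ →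
        IsCyclotomicVariable p γ →
      ∃ (F : Type) (_ : Field F) (_ : NumberField F) (V' : WeierstrassCurve F) (_ : V'.IsElliptic)
        (κF : ZpExtension F p) (γF : absoluteGaloisGroup F)
        (Φ : signedSelmerInfty V' κF 1 ≃+
          signedSelmerInfty V κ 1 × towerSignedSelmerInftyEta V κ K₀ ℚ_[p] ηq 1),
        Module.finrank ℚ F = 2 ∧ (∃ θ : F, θ ^ 2 = algebraMap ℚ F ((-1) ^ (p / 2) * p)) ∧
        (∃ C : VariableChange F, C • V.baseChange F = V') ∧
        κF.IsCyclotomic ∧ κF.IsTopGenerator γF ∧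
        (∃ ζ : ℤ_[p]ˣ, IsOfFinOrder ζ ∧
          ((GaloisRep.cyclotomicCharacter F p γF * ζ : ℤ_[p]ˣ) : ℤ_[p]) =
            (cyclotomicGenerator p : ℤ_[p])) ∧
        ∀ s : signedSelmerInfty V' κF 1,
          ((Φ ⟨V'.conjH1 p κF.kerSubgroup γF s,
              conjH1_mem_signedSelmerInfty V' κF 1 γF s.2⟩).1 : V.subgroupH1 p κ.kerSubgroup) =
            V.conjH1 p κ.kerSubgroup γ (Φ s).1 ∧
          ((Φ ⟨V'.conjH1 p κF.kerSubgroup γF s,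
              conjH1_mem_signedSelmerInfty V' κF 1 γF s.2⟩).2 :
              V.subgroupH1 p (towerTopSubgroup κ K₀)) =
            V.conjH1 p (towerTopSubgroup κ K₀) γ (Φ s).2) :
    ∀ (p : ℕ) [Fact p.Prime], 5 ≤ p →
    ∀ (K₀ : Type) [Field K₀] [NumberField K₀] [IsCyclotomicExtension {p} ℚ K₀]
      [(galRange (K := ℚ) K₀).Normal] (ηq : absoluteGaloisGroup ℚ →* ℤˣ),
      (∀ σ ∈ galRange (K := ℚ) K₀, ηq σ = 1) → ηq ≠ 1 →
    ∀ (V : WeierstrassCurve ℚ) [V.IsElliptic] [V.IsGloballyMinimal] {N : ℕ} [NeZero N]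
      {f : CuspForm (Gamma0 N) 2},
      p ≠ 2 → V.HasGoodReductionAtPrime p → V.frobeniusTrace p = 0 →
      QuadraticBranchPlusMainConjectureAt V p → IsNewformOf V f →
    ∀ (ϖ : ℚ), (if Even (p / 2) then (ϖ : ℝ) * V.realPeriodRat = plusPeriod f
        else (ϖ : ℝ) * V.imaginaryPeriodRat = minusPeriod f) →
    ∀ (Lη : IwasawaAlgebra p), IsQuadraticBranchPlusLFunction f p ϖ Lη →
    ∀ (κ : ZpExtension ℚ p) (γ : absoluteGaloisGroup ℚ),
      κ.IsCyclotomic → κ.IsTopGenerator γ → γ ∈ galRange (K := ℚ) K₀ →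
      IsCyclotomicVariable p γ →
    ∀ (D : EtaSignedSelmerDualData V κ K₀ ℚ_[p] ηq γ 1),
      Module.Finite (IwasawaAlgebra p) D.X ∧ Module.IsTorsion (IwasawaAlgebra p) D.X ∧
        D.charIdeal = Ideal.span {Lη} := by
  intro p _ hp5 K₀ _ _ _ _ ηq hηK hη1 V _ _ N _ f hp2 hgood hap h1 hf ϖ hϖ Lη hL κ γ hκ hγ hγK hγc D
  obtain ⟨F, _instF, _instNF, V', _instE, κF, γF, Φ, hF2, hθ, hCV, hκF, hγF, hζ, hΦ⟩ :=
    hdec p hp5 K₀ ηq hηK hη1 V hgood hap κ γ hκ hγ hγK hγc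
  -- Kobayashi's dual datum of `Sel⁺(V/ℚ_∞)` at `γ` (EXISTS)
  let D₀ : SignedSelmerDualData V κ γ 1 := signedSelmerDualData V κ 1 hγ
  -- the two projections of the decomposition
  let π₀ : signedSelmerInfty V' κF 1 →+ signedSelmerInfty V κ 1 :=
    (AddMonoidHom.fst _ _).comp Φ.toAddMonoidHom
  let π₁ : signedSelmerInfty V' κF 1 →+ towerSignedSelmerInftyEta V κ K₀ ℚ_[p] ηq 1 :=
    (AddMonoidHom.snd _ _).comp Φ.toAddMonoidHom
  have hπ₀ : ∀ s, π₀ s = (Φ s).1 := fun s => rfl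
  have hπ₁ : ∀ s, π₁ s = (Φ s).2 := fun s => rfl
  -- the character group of the direct sum
  let T : D₀.X × D.X →+ (signedSelmerInfty V' κF 1 →+ AddCircle (1 : ℚ)) :=
    AddMonoidHom.mk' (fun x => (D₀.toDual x.1).comp π₀ + (D.toDual x.2).comp π₁) (by
      intro x y
      simp only [Prod.fst_add, Prod.snd_add, map_add, AddMonoidHom.add_comp]
      abel)
  have hT : ∀ (x : D₀.X × D.X) (s : signedSelmerInfty V' κF 1),
      T x s = D₀.toDual x.1 (Φ s).1 + D.toDual x.2 (Φ s).2 := fun x s => rfl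
  have hTbij : Function.Bijective T :=
    bijective_dualOfProd Φ D₀.toDual D.toDual D₀.bijective D.bijective
  -- the dual datum of `Sel⁺(V'/F_∞)` on the module `D₀.X × D.X`
  let DF : SignedSelmerDualData V' κF γF 1 :=
    { X := D₀.X × D.X
      conj_mem := fun s hs => conjH1_mem_signedSelmerInfty V' κF 1 γF hs
      toDual := T
      bijective := hTbij
      toDual_T_smul := by
        intro x s
        have h0 : (Φ ⟨V'.conjH1 p κF.kerSubgroup γF s,
            conjH1_mem_signedSelmerInfty V' κF 1 γF s.2⟩).1 =
            ⟨V.conjH1 p κ.kerSubgroup γ (Φ s).1, D₀.conj_mem _ (Φ s).1.2⟩ :=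
          Subtype.ext (hΦ s).1
        have h1 : (Φ ⟨V'.conjH1 p κF.kerSubgroup γF s,
            conjH1_mem_signedSelmerInfty V' κF 1 γF s.2⟩).2 =
            ⟨V.conjH1 p (towerTopSubgroup κ K₀) γ (Φ s).2, D.conj_mem _ (Φ s).2.2⟩ :=
          Subtype.ext (hΦ s).2
        rw [hT, hT, hT, Prod.smul_fst, Prod.smul_snd, D₀.toDual_T_smul, D.toDual_T_smul, h0, h1]
        abel
      toDual_C_smul := by
        intro c x s k hk
        have hk' : (p ^ k) • Φ s = 0 := by rw [← map_nsmul, hk, map_zero]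
        have hk0 : (p ^ k) • (Φ s).1 = 0 := by
          have := congrArg Prod.fst hk'; simpa using this
        have hk1 : (p ^ k) • (Φ s).2 = 0 := by
          have := congrArg Prod.snd hk'; simpa using this
        rw [hT, hT, Prod.smul_fst, Prod.smul_snd, D₀.toDual_C_smul c x.1 _ k hk0,
          D.toDual_C_smul c x.2 _ k hk1, smul_add] }
  -- (C1_η) at the quadratic model, with `D₀` and `DF`
  obtain ⟨hfin, htor, hchar⟩ :=
    h1 F V' hp2 hgood hap hF2 hθ hCV hκ hγ hγc hκF hγF hζ hf ϖ hϖ Lη hL D₀ DF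
  -- the `Λ`-algebra
  exact finite_isTorsion_charIdeal_snd_of_prod Lη hfin htor hchar

end Summit.BirchSwinnertonDyer.BirchSwinnertonDyer.Theorems

end
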